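import Summits.CriticalPhenomena.PercolationContinuityZ3.Theorems.FK.InfiniteVolumeMeasures
import Summits.CriticalPhenomena.PercolationContinuityZ3.Theorems.FK.DomainMarkovToolkit
import Summits.CriticalPhenomena.PercolationContinuityZ3.Theorems.FK.TwoPointFunctionTail
import Literature.Probability.Percolation.LocalLimitConnections
import Literature.Barriers.CriticalPhenomena.LaceExpansionHighDimension
import HarnessLib

/-!
# FK-continuity transplant, FO-08 (e): mixing of `φ^b_{p,q}` on local events along `|v| → ∞`
# (Grimmett 2006, Cor. (4.23)) from the DLR sandwich, and `τ^b(0,u) → (θ^b)²` (eq. (5.32))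

Cell `fk-continuity` (bschramm), row FO-08; support file for the FK-continuity transplant
(`--supports stmt-CriticalPhenomena-4575`); builds on p205010 (kernel theorem, internal audit signed;
external expert review pending).

For a box limit `P = φ^b_{p,q}` (`IsBoxLimit d b p q P`, `InfiniteVolumeDefs.lean`) which satisfies the
free/wired sandwich form of the DLR property (`FKGibbs d p q P`, `InfiniteVolumeGibbs.lean`; row
FO-06a-2 proves `IsBoxLimit.fkGibbs`) and is translation invariant (row FO-06b,
`IsBoxLimit.measurePreserving_relabel_shift`) — both taken here as HYPOTHESES `hG`, `hT` in exactly
the shapes those rows deliver — we prove: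

* `FKGibbs.abs_real_inter_sub_mul_le_sub_regionFreeReal` / `…_le_regionWiredReal_sub` — the
  covariance estimate behind Grimmett's proof of tail-triviality (Thm. (4.19)(d), p. 79, first
  display): for `A` increasing and determined inside `Λ`, `C` determined outside `E_Λ`,
  `|P(A ∩ C) - P(A)P(C)| ≤ P(A) - φ⁰_Λ(A)` and `≤ φ¹_Λ(A) - P(A)` (from the two sandwich fields
  applied to `C` and to `Cᶜ`);
* `IsBoxLimit.tendsto_real_inter_preimage_shift_cofinite` — **mixing on local events** (Grimmett
  2006, Cor. (4.23) in the form used on p. 107): `P(A ∩ τ_v B) → P(A) P(B)` as `|v| → ∞`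
  (`Filter.cofinite` on `ℤ^d`) for all local `A, B`; first for increasing cylinders `{E₀ ⊆ ω}`
  (`E₀` lattice edges: the estimate above with `Λ = Λ_m`, `φ^b_{Λ_m}(A) → P(A)`, and the translate of
  `B` determined outside `E_{Λ_m}` for cofinitely many `v`; non-lattice `E₀`: both sides vanish),
  then for all local `A` by inclusion–exclusion over cylinders
  (`tendsto_measureReal_of_isLocalEvent_of_tendsto_supset`, the identified-limit, general-filter
  form of `InfiniteVolumeCylinders.lean`; the translate of a local event is determined by the
  translated pairs — the tree's `Literature.Barriers.CriticalPhenomena.determinedBy_preimage_relabel`);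
* `IsBoxLimit.tendsto_real_openConn_cofinite` — **Grimmett 2006, eq. (5.32) for `φ^b_{p,q}`**:
  `φ^b_{p,q}(0 ↔ u) → φ^b_{p,q}(0 ↔ ∞)²` as `|u| → ∞`, given in addition a.s. uniqueness of the
  infinite cluster (row FO-08, `IsBoxLimit.ae_numInfiniteClusters_le_one`), by the generic
  `tendsto_real_openConn_cofinite` of `TwoPointFunctionTail.lean`.

## References

* G. Grimmett, *The Random-Cluster Model*, Springer 2006: Thm. (4.19)(d) and its proof (p. 79),
  Cor. (4.23) (p. 78), Thm. (5.17) with the proof of (5.32) (p. 107). [Grimmett2006]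
-/

noncomputable section

open MeasureTheory Set Filter
open scoped ENNReal NNReal Topology

namespace Summit.CriticalPhenomena.PercolationContinuityZ3.Theorems.FK

open Literature.Probability.Percolation Literature.Probability.LatticeModels

/-! ### From increasing cylinders to all local events, along any filter, with identified limits -/

section Cylinders

variable {ι κ : Type*} {l : Filter κ}

/-- **Inclusion–exclusion, one coordinate at a time (identified limits).** If finite measures
`g k` converge along a filter to `ν` on every increasing cylinder `{E₀ ⊆ ω}`, they converge to `ν`
on every cylinder event. [cite: Grimmett2006, Thm. (4.19)(a), proof] -/
theorem tendsto_measureReal_cylEvent_of_tendsto_supset (g : κ → Measure (Set ι)) (ν : Measure (Set ι))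
    [∀ k, IsFiniteMeasure (g k)] [IsFiniteMeasure ν]
    (h : ∀ E₀ : Finset ι, Tendsto (fun k => (g k).real {ω | (↑E₀ : Set ι) ⊆ ω}) l
      (𝓝 (ν.real {ω | (↑E₀ : Set ι) ⊆ ω})))
    (E₀ S : Finset ι) :
    Tendsto (fun k => (g k).real (cylEvent E₀ S)) l (𝓝 (ν.real (cylEvent E₀ S))) := by
  classical
  suffices H : ∀ n : ℕ, ∀ E₀ S : Finset ι, (E₀ \ S).card = n →
      Tendsto (fun k => (g k).real (cylEvent E₀ S)) l (𝓝 (ν.real (cylEvent E₀ S))) from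
    H _ E₀ S rfl
  intro n
  induction n with
  | zero =>
    intro E₀ S hk
    rw [Finset.card_eq_zero, Finset.sdiff_eq_empty_iff_subset] at hk
    rw [cylEvent_eq_setOf_subset hk]
    exact h E₀
  | succ n ih =>
    intro E₀ S hk
    obtain ⟨e₀, he₀⟩ : (E₀ \ S).Nonempty := by
      rw [← Finset.card_pos, hk]
      exact Nat.succ_pos n
    rw [Finset.mem_sdiff] at he₀
    obtain ⟨he₀E, he₀S⟩ := he₀
    have hk1 : (E₀.erase e₀ \ S).card = n := by
      rw [Finset.erase_sdiff_comm, Finset.card_erase_of_mem (Finset.mem_sdiff.2 ⟨he₀E, he₀S⟩), hk]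
      rfl
    have hk2 : (E₀ \ insert e₀ S).card = n := by
      rw [Finset.sdiff_insert, Finset.card_erase_of_mem (Finset.mem_sdiff.2 ⟨he₀E, he₀S⟩), hk]
      rfl
    have heq : ∀ μ : Measure (Set ι), IsFiniteMeasure μ → μ.real (cylEvent E₀ S) =
        μ.real (cylEvent (E₀.erase e₀) S) - μ.real (cylEvent E₀ (insert e₀ S)) := by
      intro μ _
      rw [cylEvent_erase_eq_union he₀S,
        measureReal_union (disjoint_cylEvent_insert he₀E he₀S) (measurableSet_cylEvent _ _)]
      ring
    rw [heq ν inferInstance]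
    simp_rw [heq (g _) inferInstance]
    exact (ih (E₀.erase e₀) S hk1).sub (ih E₀ (insert e₀ S) hk2)

/-- **From increasing cylinders to local events (identified limits, any filter)**: if finite
measures `g k` converge to `ν` on every increasing cylinder `{E₀ ⊆ ω}`, then `g k (A) → ν(A)` for
every local event `A` (a local event determined by the finite set `F` is the disjoint union of the
cylinders `C(F,S)` it contains). [cite: Grimmett2006, §4.1 with Thm. (4.19)(a), proof] -/
theorem tendsto_measureReal_of_isLocalEvent_of_tendsto_supset (g : κ → Measure (Set ι))
    (ν : Measure (Set ι)) [∀ k, IsFiniteMeasure (g k)] [IsFiniteMeasure ν]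
    (h : ∀ E₀ : Finset ι, Tendsto (fun k => (g k).real {ω | (↑E₀ : Set ι) ⊆ ω}) l
      (𝓝 (ν.real {ω | (↑E₀ : Set ι) ⊆ ω})))
    {A : Set (Set ι)} (hA : IsLocalEvent A) :
    Tendsto (fun k => (g k).real A) l (𝓝 (ν.real A)) := by
  classical
  obtain ⟨F, hF⟩ := hA
  rw [determinedBy_iff] at hF
  set T : Finset (Finset ι) := F.powerset.filter fun S => ((S : Set ι) ∈ A) with hT
  have hdec : A = ⋃ S ∈ T, cylEvent F S := by
    ext ω
    simp only [Set.mem_iUnion, hT, Finset.mem_filter, Finset.mem_powerset, exists_prop]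
    constructor
    · intro hω
      refine ⟨F.filter (· ∈ ω), ⟨Finset.filter_subset _ _, ?_⟩, ?_⟩
      · refine (hF ω _ ?_).1 hω
        ext e
        simp only [Set.mem_inter_iff, Finset.mem_coe, Finset.coe_filter, Set.mem_setOf_eq]
        tauto
      · rw [mem_cylEvent_iff]
        intro e he
        simp only [Finset.mem_filter]
        tauto
    · rintro ⟨S, ⟨-, hSA⟩, hω⟩
      rw [mem_cylEvent_iff] at hω
      refine (hF ω S ?_).2 hSA
      ext e
      simp only [Set.mem_inter_iff, Finset.mem_coe]
      exact ⟨fun h' => ⟨(hω e h'.2).1 h'.1, h'.2⟩, fun h' => ⟨(hω e h'.2).2 h'.1, h'.2⟩⟩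
  have hdisj : (T : Set (Finset ι)).PairwiseDisjoint fun S => cylEvent F S := by
    intro S hS S' hS' hne
    have hSF : S ⊆ F := Finset.mem_powerset.1 (Finset.mem_filter.1 hS).1
    have hS'F : S' ⊆ F := Finset.mem_powerset.1 (Finset.mem_filter.1 hS').1
    exact disjoint_cylEvent_of_ne hSF hS'F hne
  have hsum : ∀ μ : Measure (Set ι), IsFiniteMeasure μ → μ.real A = ∑ S ∈ T, μ.real (cylEvent F S) := by
    intro μ _
    rw [hdec]
    exact measureReal_biUnion_finset hdisj fun S _ => measurableSet_cylEvent F S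
  rw [hsum ν inferInstance]
  simp_rw [hsum (g _) inferInstance]
  exact tendsto_finsetSum _ fun S _ => tendsto_measureReal_cylEvent_of_tendsto_supset g ν h F S

end Cylinders

/-! ### The covariance estimate from the DLR sandwich -/

section Sandwich

variable {d : ℕ} {p q : ℝ} {P : Measure (BondConfig (Site d))}

/-- **Covariance estimate, free side** (Grimmett 2006, proof of Thm. (4.19)(d), p. 79, for
`b = 0`): for a measure with the DLR sandwich property, `A` increasing and determined inside the
finite region `Λ`, and `C` determined by finitely many pairs off `E_Λ`,
`|P(A ∩ C) - P(A) P(C)| ≤ P(A) - φ⁰_Λ(A)` — the lower sandwich applied to `C` and to `Cᶜ`.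
[cite: Grimmett2006, Thm. (4.19)(d) (proof, p. 79)] -/
theorem FKGibbs.abs_real_inter_sub_mul_le_sub_regionFreeReal (hG : FKGibbs d p q P)
    (Λ : Finset (Site d)) {A C : Set (BondConfig (Site d))} (T : Finset (Sym2 (Site d)))
    (hA : IsUpperSet A) (hAΛ : DeterminedBy A ↑(edgesIn (zdGraph d) Λ))
    (hT : Disjoint (↑T : Set (Sym2 (Site d))) ↑(edgesIn (zdGraph d) Λ)) (hC : DeterminedBy C ↑T) :
    |P.real (A ∩ C) - P.real A * P.real C| ≤ P.real A - regionFreeReal d p q Λ A := by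
  haveI := hG.isProbabilityMeasure
  have hCm : MeasurableSet C := hC.measurableSet_of_finset
  have h1 := hG.free_mul_le Λ T hA hAΛ hT hC
  have h2 := hG.free_mul_le Λ T hA hAΛ hT hC.compl
  have hsplit : P.real (A ∩ C) + P.real (A ∩ Cᶜ) = P.real A := by
    rw [← Set.sdiff_eq]
    exact measureReal_inter_add_sdiff (μ := P) (s := A) hCm
  have hcompl : P.real Cᶜ = 1 - P.real C := probReal_compl_eq_one_sub hCm
  have hφ : regionFreeReal d p q Λ A ≤ P.real A := hG.regionFreeReal_le Λ hA hAΛ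
  have hC1 : P.real C ≤ 1 := measureReal_le_one
  have hC0 : 0 ≤ P.real C := measureReal_nonneg
  rw [abs_sub_le_iff]
  rw [hcompl] at h2
  constructor <;> nlinarith

/-- **Covariance estimate, wired side** (Grimmett 2006, proof of Thm. (4.19)(d), p. 79, for
`b = 1`): `|P(A ∩ C) - P(A) P(C)| ≤ φ¹_Λ(A) - P(A)` (the upper sandwich applied to `C` and to `Cᶜ`).
[cite: Grimmett2006, Thm. (4.19)(d) (proof, p. 79)] -/
theorem FKGibbs.abs_real_inter_sub_mul_le_regionWiredReal_sub (hG : FKGibbs d p q P)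
    (Λ : Finset (Site d)) {A C : Set (BondConfig (Site d))} (T : Finset (Sym2 (Site d)))
    (hA : IsUpperSet A) (hAΛ : DeterminedBy A ↑(edgesIn (zdGraph d) Λ))
    (hT : Disjoint (↑T : Set (Sym2 (Site d))) ↑(edgesIn (zdGraph d) Λ)) (hC : DeterminedBy C ↑T) :
    |P.real (A ∩ C) - P.real A * P.real C| ≤ regionWiredReal d p q Λ A - P.real A := by
  haveI := hG.isProbabilityMeasure
  have hCm : MeasurableSet C := hC.measurableSet_of_finset
  have h1 := hG.le_wired_mul Λ T hA hAΛ hT hC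
  have h2 := hG.le_wired_mul Λ T hA hAΛ hT hC.compl
  have hsplit : P.real (A ∩ C) + P.real (A ∩ Cᶜ) = P.real A := by
    rw [← Set.sdiff_eq]
    exact measureReal_inter_add_sdiff (μ := P) (s := A) hCm
  have hcompl : P.real Cᶜ = 1 - P.real C := probReal_compl_eq_one_sub hCm
  have hφ : P.real A ≤ regionWiredReal d p q Λ A := hG.le_regionWiredReal Λ hA hAΛ
  have hC1 : P.real C ≤ 1 := measureReal_le_one
  have hC0 : 0 ≤ P.real C := measureReal_nonneg
  rw [abs_sub_le_iff]
  rw [hcompl] at h2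
  constructor <;> nlinarith

end Sandwich

/-! ### Translates of local events: the shifted pairs eventually avoid every box -/

section Shift

variable {d : ℕ}

/-- **The translated pairs eventually leave every box**: for a finite set `F` of pairs and a box
`Λ_m`, for all but finitely many `v ∈ ℤ^d` no pair of `Λ_m`-edges is carried into `F` by the shift
`x ↦ x + v`. [folklore] -/
theorem eventually_cofinite_disjoint_preimage_shift (F : Finset (Sym2 (Site d))) (m : ℕ) :
    ∀ᶠ v : Site d in cofinite,
      Disjoint ((sym2Equiv (Site.shift v)) ⁻¹' (↑F : Set (Sym2 (Site d))))
        ↑(edgesIn (zdGraph d) (box d m)) := by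
  filter_upwards [(box d (F.sup pairRad + m)).eventually_cofinite_notMem] with v hv
  rw [Set.disjoint_left]
  intro e he he'
  rw [Set.mem_preimage, Finset.mem_coe, sym2Equiv_apply] at he
  rw [Finset.mem_coe, mem_edgesIn_iff] at he'
  -- pick an endpoint `a` of `e`; then `a ∈ Λ_m` and `a + v` lies in a pair of `F`
  induction e using Sym2.ind with
  | h a b =>
    have ha : a ∈ box d m := he'.2 a (Sym2.mem_mk_left a b)
    have hav : a + v ∈ Sym2.map (Site.shift v) s(a, b) :=
      Sym2.mem_map.2 ⟨a, Sym2.mem_mk_left a b, rfl⟩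
    have hav' : a + v ∈ box d (F.sup pairRad) :=
      forall_mem_box_of_sup_pairRad_le le_rfl _ he _ hav
    apply hv
    rw [mem_box_iff_siteRad_le] at ha hav' ⊢
    have h1 := siteRad_add_le (a + v) (-a)
    rw [add_neg_cancel_comm, siteRad_neg] at h1
    omega

end Shift

/-! ### Mixing of box limits on local events (Grimmett 2006, Cor. (4.23)) -/

section Mixing

variable {d : ℕ} {b : Bool} {p q : ℝ} {P : Measure (BondConfig (Site d))}

/-- **Mixing on increasing cylinders.** For a translation-invariant box limit with the DLR sandwich
property, `E₀` finite and `B` local: `P({E₀ ⊆ ω} ∩ τ_v B) → P(E₀ ⊆ ω) P(B)` as `|v| → ∞`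
(Grimmett 2006, proof of Thm. (4.19)(d) and Cor. (4.23): the covariance estimate with `Λ = Λ_m`,
`φ^b_{Λ_m}(A) → P(A)`, the translate of `B` being determined off `E_{Λ_m}` for cofinitely many `v`).
[cite: Grimmett2006, Cor. (4.23) p. 78 (with the proof of Thm. (4.19)(d), p. 79)] -/
theorem IsBoxLimit.tendsto_real_setOf_subset_inter_preimage_shift_cofinite (hP : IsBoxLimit d b p q P)
    (hG : FKGibbs d p q P)
    (hT : ∀ v : Site d, MeasurePreserving (BondConfig.relabel (sym2Equiv (Site.shift v))) P P)
    (hp : p ∈ Set.Icc (0 : ℝ) 1) (hq : 0 < q) (E₀ : Finset (Sym2 (Site d)))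
    {B : Set (BondConfig (Site d))} (hB : IsLocalEvent B) :
    Tendsto (fun v : Site d => P.real ({ω | (↑E₀ : Set (Sym2 (Site d))) ⊆ ω} ∩
        BondConfig.relabel (sym2Equiv (Site.shift v)) ⁻¹' B)) cofinite
      (𝓝 (P.real {ω | (↑E₀ : Set (Sym2 (Site d))) ⊆ ω} * P.real B)) := by
  classical
  haveI := hP.isProbabilityMeasure
  set A : Set (BondConfig (Site d)) := {ω | (↑E₀ : Set (Sym2 (Site d))) ⊆ ω} with hA_def
  have hAm : MeasurableSet A := measurableSet_setOf_subset E₀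
  have hBm : MeasurableSet B := measurableSet_of_isLocalEvent_holds hB
  obtain ⟨F, hF⟩ := hB
  -- the translates of `B` and their probabilities
  have hCdet : ∀ v : Site d, DeterminedBy (BondConfig.relabel (sym2Equiv (Site.shift v)) ⁻¹' B)
      ↑(F.preimage (sym2Equiv (Site.shift v)) (sym2Equiv (Site.shift v)).injective.injOn) := by
    intro v
    rw [Finset.coe_preimage]
    exact Literature.Barriers.CriticalPhenomena.determinedBy_preimage_relabel _ hF
  have hCreal : ∀ v : Site d, P.real (BondConfig.relabel (sym2Equiv (Site.shift v)) ⁻¹' B) = P.real B := by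
    intro v
    rw [measureReal_def, measureReal_def, (hT v).measure_preimage hBm.nullMeasurableSet]
  by_cases hE : (↑E₀ : Set (Sym2 (Site d))) ⊆ (zdGraph d).edgeSet
  · -- `A` is increasing, local, and determined inside every large box
    have hAup : IsUpperSet A := fun ω ω' hle hω => Set.Subset.trans hω hle
    have hAloc : IsLocalEvent A := isLocalEvent_setOf_subset E₀
    have hAdet : ∀ m, E₀.sup pairRad ≤ m → DeterminedBy A ↑(edgesIn (zdGraph d) (box d m)) := by
      intro m hm
      refine (determinedBy_setOf_subset E₀).mono ((subset_edgesIn_box_of_subset_edgeSet hE).trans ?_)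
      exact Finset.coe_subset.2 (edgesIn_zdGraph_mono (box_mono d hm))
    rw [Metric.tendsto_nhds]
    intro ε hε
    -- choose `m` with `|φ^b_{Λ_m}(A) - P(A)| < ε`
    have hlim := hP.tendsto_real hAloc
    obtain ⟨m, hm₀, hm⟩ : ∃ m, E₀.sup pairRad ≤ m ∧ |(rcBoxLaw d b p q m).real A - P.real A| < ε := by
      obtain ⟨m, hm⟩ := ((eventually_ge_atTop (E₀.sup pairRad)).and
        (Metric.tendsto_nhds.1 hlim ε hε)).exists
      exact ⟨m, hm.1, by rw [← Real.dist_eq]; exact hm.2⟩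
    filter_upwards [eventually_cofinite_disjoint_preimage_shift F m] with v hv
    rw [Real.dist_eq, hA_def]
    have hdisj : Disjoint (↑(F.preimage (sym2Equiv (Site.shift v))
        (sym2Equiv (Site.shift v)).injective.injOn) : Set (Sym2 (Site d)))
        ↑(edgesIn (zdGraph d) (box d m)) := by
      rw [Finset.coe_preimage]; exact hv
    have hcov : |P.real (A ∩ BondConfig.relabel (sym2Equiv (Site.shift v)) ⁻¹' B) -
        P.real A * P.real (BondConfig.relabel (sym2Equiv (Site.shift v)) ⁻¹' B)| ≤
        |(rcBoxLaw d b p q m).real A - P.real A| := by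
      cases b with
      | false =>
        have h := hG.abs_real_inter_sub_mul_le_sub_regionFreeReal (box d m) _ hAup (hAdet m hm₀)
          hdisj (hCdet v)
        rw [regionFreeReal_box p q m hAm] at h
        exact h.trans (by rw [abs_sub_comm]; exact le_abs_self _)
      | true =>
        have h := hG.abs_real_inter_sub_mul_le_regionWiredReal_sub (box d m) _ hAup (hAdet m hm₀)
          hdisj (hCdet v)
        rw [regionWiredReal_box p q m hAm] at h
        exact h.trans (le_abs_self _)
    rw [hCreal v] at hcov
    exact hcov.trans_lt hm
  · -- a non-lattice pair in `E₀`: `A` is null and both sides vanish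
    have hA0 : P.real A = 0 := by
      rw [Set.not_subset] at hE
      obtain ⟨e, he, heE⟩ := hE
      have hsub : A ⊆ {ω : BondConfig (Site d) | ¬ ω ⊆ (zdGraph d).edgeSet} :=
        fun ω hω hωE => heE (hωE (hω he))
      rw [measureReal_def, measure_mono_null hsub (ae_iff.1 (hP.ae_subset_edgeSet hp hq)),
        ENNReal.toReal_zero]
    have h0 : ∀ v : Site d, P.real (A ∩ BondConfig.relabel (sym2Equiv (Site.shift v)) ⁻¹' B) = 0 :=
      fun v => le_antisymm ((measureReal_mono Set.inter_subset_left).trans hA0.le) measureReal_nonneg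
    simp only [h0, hA0, zero_mul]
    exact tendsto_const_nhds

/-- **Grimmett 2006, Cor. (4.23) — mixing of `φ^b_{p,q}` on local events along `|v| → ∞`**: for a
box limit `P` with the DLR sandwich property (`hG`, row FO-06a) and translation invariance (`hT`,
row FO-06b), and all local events `A, B`: `P(A ∩ τ_v B) → P(A) P(B)` along the cofinite filter of
`ℤ^d`. [cite: Grimmett2006, Cor. (4.23) p. 78] -/
theorem IsBoxLimit.tendsto_real_inter_preimage_shift_cofinite (hP : IsBoxLimit d b p q P)
    (hG : FKGibbs d p q P)
    (hT : ∀ v : Site d, MeasurePreserving (BondConfig.relabel (sym2Equiv (Site.shift v))) P P)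
    (hp : p ∈ Set.Icc (0 : ℝ) 1) (hq : 0 < q) {A B : Set (BondConfig (Site d))}
    (hA : IsLocalEvent A) (hB : IsLocalEvent B) :
    Tendsto (fun v : Site d => P.real (A ∩ BondConfig.relabel (sym2Equiv (Site.shift v)) ⁻¹' B))
      cofinite (𝓝 (P.real A * P.real B)) := by
  haveI := hP.isProbabilityMeasure
  have hBm : MeasurableSet B := measurableSet_of_isLocalEvent_holds hB
  have hCm : ∀ v : Site d, MeasurableSet (BondConfig.relabel (sym2Equiv (Site.shift v)) ⁻¹' B) :=
    fun v => (BondConfig.relabel (sym2Equiv (Site.shift v))).measurable hBm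
  -- the restricted measures `P(· ∩ τ_v B)` and the target `P(B) · P`
  set g : Site d → Measure (BondConfig (Site d)) :=
    fun v => P.restrict (BondConfig.relabel (sym2Equiv (Site.shift v)) ⁻¹' B) with hg
  set ν : Measure (BondConfig (Site d)) := (P.real B).toNNReal • P with hν
  haveI : ∀ v, IsFiniteMeasure (g v) := fun v => by rw [hg]; infer_instance
  haveI : IsFiniteMeasure ν := by rw [hν]; infer_instance
  have hgA : ∀ v {X : Set (BondConfig (Site d))}, MeasurableSet X →
      (g v).real X = P.real (X ∩ BondConfig.relabel (sym2Equiv (Site.shift v)) ⁻¹' B) :=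
    fun v X hX => by rw [hg, measureReal_restrict_apply hX]
  have hνA : ∀ X : Set (BondConfig (Site d)), ν.real X = P.real X * P.real B := by
    intro X
    rw [hν, measureReal_nnreal_smul_apply, Real.coe_toNNReal _ measureReal_nonneg, mul_comm]
  have hAm : MeasurableSet A := measurableSet_of_isLocalEvent_holds hA
  have h := tendsto_measureReal_of_isLocalEvent_of_tendsto_supset g ν (l := cofinite)
    (fun E₀ => by
      simp_rw [hgA _ (measurableSet_setOf_subset E₀), hνA]
      exact hP.tendsto_real_setOf_subset_inter_preimage_shift_cofinite hG hT hp hq E₀ hB) hA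
  simp_rw [hgA _ hAm, hνA] at h
  exact h

/-! ### Grimmett 2006, eq. (5.32) for the random-cluster measures -/

/-- **Grimmett 2006, eq. (5.32) for `φ^b_{p,q}`**: for a box limit `P = φ^b_{p,q}` (`0 ≤ p ≤ 1`,
`q > 0`, either boundary condition) with the DLR sandwich property (`hG`: row FO-06a,
`IsBoxLimit.fkGibbs`), translation invariance (`hT`: row FO-06b,
`IsBoxLimit.measurePreserving_relabel_shift`) and almost surely at most one infinite cluster
(`huniq`: row FO-08, `IsBoxLimit.ae_numInfiniteClusters_le_one`), the two-point function converges
to the square of the percolation probability: `P(0 ↔ u) → P(0 ↔ ∞)²` as `|u| → ∞`.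
[cite: Grimmett2006, Thm. (5.17), proof of eq. (5.32), p. 107] -/
theorem IsBoxLimit.tendsto_real_openConn_cofinite (hP : IsBoxLimit d b p q P) (hG : FKGibbs d p q P)
    (hT : ∀ v : Site d, MeasurePreserving (BondConfig.relabel (sym2Equiv (Site.shift v))) P P)
    (hp : p ∈ Set.Icc (0 : ℝ) 1) (hq : 0 < q) (huniq : ∀ᵐ ω ∂P, numInfiniteClusters ω ≤ 1) :
    Tendsto (fun u : Site d => P.real (openConn (0 : Site d) u)) cofinite
      (𝓝 (P.real (percolatesAt (0 : Site d)) ^ 2)) := by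
  haveI := hP.isProbabilityMeasure
  exact FK.tendsto_real_openConn_cofinite P (hP.ae_subset_edgeSet hp hq) hT
    (fun A B hA hB => hP.tendsto_real_inter_preimage_shift_cofinite hG hT hp hq hA hB) huniq

end Mixing

end Summit.CriticalPhenomena.PercolationContinuityZ3.Theorems.FK

end
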